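import Mathlib
import Literature.NumberTheory.LFunctions.Zhang2022.DeltaContourShift
import Literature.NumberTheory.LFunctions.Zhang2022.Section16AU015
import Literature.NumberTheory.LFunctions.Zhang2022.Section15KappaTilde1Analytic
import Literature.NumberTheory.LFunctions.Zhang2022.TypedSection15AIdentities
import Literature.NumberTheory.LFunctions.Zhang2022.Section8Lemma82
import Literature.NumberTheory.LFunctions.Zhang2022.Section14GaussSums
import Literature.NumberTheory.LFunctions.Zhang2022.SkeletonWindowPowers
import HarnessLib

/-!
# Zhang (2022) §15 p. 82, node `Z22:§15.u021`: the contour shift of (15.8) to the exceptional zero —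
# `Σ_{(l₁,d₂k)=1} κ₁(d₁l₁)χ(l₁)Δ(l₁l₂/(Dpk)) = 𝓡₁*(Dpk/l₂)κ̃₁(d₁;d₂k)λ₁(d₁d₂k) + O(α¹⁰⁰τ₃(d₁)Dpk/l₂)` —
# DISCHARGED (as printed, and for all `l₂` with `l₂T ≤ Dpk`)

Topic `Literature/NumberTheory/LFunctions/Zhang2022` (Landau–Siegel audit tree; verdict-neutral).
Y. Zhang, *Discrete mean estimates and the Landau–Siegel zero*, arXiv:2211.02515v1 (2022)
[Zhang2022LandauSiegel] — **an unrefereed manuscript under adjudication** (ZHANG-L discharge lane, WP15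
leaf `Typed.Section15B.Eq15_17 c' bChi`). Node `Z22:§15.u021` [Z22 p. 82, tex L4129], typed AS PRINTED as
`Typed.Section15A.Step15_u021`: "Note that `Dpk/l₂ > T` if `l₂ < PT⁻²`. In a way similar to the treatment
of (7.19), by Lemma 5.5, we see that the expression (15.8) is equal to the residue of the integrand at
`s = ρ̃` plus an acceptable error. Further, by (5.15), in the expression for this residue, we can replace
`ρ̃` by `1` with an acceptable error. Thus `Σ_{(l₁,d₂k)=1} κ₁(d₁l₁)χ(l₁)Δ(l₁l₂/(Dpk))
= 𝓡₁*(Dpk/l₂)κ̃₁(d₁;d₂k)λ₁(d₁d₂k) + O(α¹⁰⁰τ₃(d₁)Dpk/l₂)`".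

The §15 twin of `Zhang2022/Section16AU015.lean`: the engine `DeltaContourShift.deltaContourShift`
(p478719) with `G(s) = κ̃₁(d₁;d₂k,s)·λ₁(d₁d₂k,s)·L(s+β₁,χ)L(s+β₂,χ)`, `y = Dpk/l₂`, after (15.8)
(`eq15_8_holds`) and u020 (`step15_u020_holds`: the Mellin integrand of (15.8) is `G(s)L(s,χ)⁻¹yˢδ(s)`
on `σ = 2`); the holomorphy and the majorant `‖κ̃₁‖ ≤ τ₃(d₁)Σ_{h∈𝔫(d₁)}τ₃(h)h^{−σ₀}` of `κ̃₁` are the tree's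
`Typed.Section15A.differentiableOn_kappaTilde1` / `norm_kappaTilde1_le` (`Section15KappaTilde1Analytic`).

* `tsum_tau_three_nset_le` — `Σ_{h∈𝔫(d₁)} τ₃(h)h^{−σ₀} = ∏_{q∣d₁}(1 − q^{−σ₀})⁻³ ≤ ∏_{q∣d₁}(1 + 192q^{−σ₀})`
  (`σ₀ ≥ 1/2`; `τ₃(qⁿ) = binom(n+2,2)`);
* `norm_lam1_le_prod`, `differentiableAt_lam1` — `|λ₁(n,s)| ≤ ∏_{q∣n}(1 + 15q^{−σ})` (`σ ≥ 1/2`);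
* `norm_G15_le` — on the contour region, `‖G(s)‖ ≤ τ₃(d₁)·2⁴¹⁶e²⁴⁸⁴𝓛⁴³²`, POINTWISE polynomial in `𝓛`
  uniformly in `d₂, k` (the Euler weights are absorbed on `σ ≥ 1 − 1/(16𝓛)` by
  `Lemma84.prod_primeFactors_le`, so the typed `τ₃(d₁)` weight is the derivable one);
* `step15_u021_master` — error `C·τ₃(d₁)·𝓛⁻¹⁵⁰⁰·Dpk/l₂` for all `l₂ ≥ 1` with `l₂T ≤ Dpk`;
* `step15_u021_holds : Step15_u021 c'` — **node `Z22:§15.u021` DISCHARGED as printed** (`l₂ < PT⁻²`).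

No new definitions, no named facts, no `sorry`. CONDITIONAL on (A) exactly as the manuscript; nothing
here bears on Theorems 1–2 of the source or on Landau–Siegel zeros.

## References

* Y. Zhang, arXiv:2211.02515v1 (2022), §15 p. 82 (u019–u022, (15.8)–(15.10)), tex L4103–L4136; §7
  p. 40; §5 Lemma 5.5, (5.15). [cite: Zhang2022LandauSiegel, §15 p.82 (u021)]
-/

noncomputable section

open Complex Real MeasureTheory Set Filter Topology Metric
open Literature.NumberTheory.LFunctions.Zhang2022
open Literature.NumberTheory.LFunctions.Zhang2022.Skeleton
open Literature.NumberTheory.LFunctions.Zhang2022.MeanSquareMajorant (tau)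

namespace Literature.NumberTheory.LFunctions.Zhang2022.Typed.Section15A

/-! ## §1. The Euler product `Σ_{h∈𝔫(d₁)} τ₃(h)h^{−σ₀} = ∏_{q∣d₁}(1 − q^{−σ₀})⁻³` and its size -/

section TauThree

/-- `τ₃(qⁿ) = binom(n+2, 2)` for a prime `q` (`τ₃(qⁿ) = Σ_{i≤n} τ₂(qⁱ) = Σ_{i≤n}(i+1)`). [folklore] -/
private theorem tau_three_prime_pow {q : ℕ} (hq : q.Prime) (n : ℕ) :
    tau 3 (q ^ n) = ((n + 2).choose 2 : ℕ) := by
  rw [show (3 : ℕ) = 2 + 1 from rfl, MeanSquareMajorant.tau_succ_apply, Nat.sum_divisors_prime_pow hq]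
  have h2 : ∀ i : ℕ, tau 2 (q ^ i) = (i : ℝ) + 1 := fun i => by
    rw [MeanSquareMajorant.tau_two_apply, Nat.divisors_prime_pow hq, Finset.card_map, Finset.card_range]
    push_cast; ring
  simp_rw [h2]
  induction n with
  | zero => simp
  | succ m ih =>
    rw [Finset.sum_range_succ, ih]
    rw [show m + 1 + 2 = (m + 2) + 1 from by ring, Nat.choose_succ_succ (m + 2) 1,
      Nat.choose_one_right]
    push_cast
    ring

/-- For a prime `q` and `σ ≥ 1/2`: `0 ≤ q^{−σ} ≤ 3/4`. [folklore] -/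
private theorem prime_rpow_neg_le' {q : ℕ} (hq : q.Prime) {σ : ℝ} (hσ : 1 / 2 ≤ σ) :
    0 ≤ (q : ℝ) ^ (-σ) ∧ (q : ℝ) ^ (-σ) ≤ 3 / 4 := by
  have hq2 : (2 : ℝ) ≤ q := by exact_mod_cast hq.two_le
  have hq0 : (0 : ℝ) < q := by linarith
  refine ⟨Real.rpow_nonneg hq0.le _, ?_⟩
  have h1 : (q : ℝ) ^ (-σ) ≤ (q : ℝ) ^ (-(1 / 2 : ℝ)) :=
    Real.rpow_le_rpow_of_exponent_le (by linarith) (by linarith)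
  have h2 : (q : ℝ) ^ (-(1 / 2 : ℝ)) ≤ (2 : ℝ) ^ (-(1 / 2 : ℝ)) :=
    Real.rpow_le_rpow_of_nonpos (by norm_num) hq2 (by norm_num)
  have h3 : (2 : ℝ) ^ (-(1 / 2 : ℝ)) ≤ 3 / 4 := by
    rw [Real.rpow_neg (by norm_num : (0 : ℝ) ≤ 2), ← Real.sqrt_eq_rpow]
    rw [inv_le_comm₀ (Real.sqrt_pos.mpr (by norm_num)) (by norm_num)]
    rw [show ((3 : ℝ) / 4)⁻¹ = 4 / 3 by norm_num, Real.le_sqrt (by norm_num)]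
    all_goals norm_num
  linarith

/-- The local factor: **`Σ_n τ₃(qⁿ)q^{−nσ₀} = (1 − q^{−σ₀})⁻³ ≤ 1 + 192q^{−σ₀}`** (`σ₀ ≥ 1/2`,
`x = q^{−σ₀} ≤ 3/4`: `(1−x)⁻³ − 1 = x(3 − 3x + x²)/(1−x)³ ≤ 3x·64`). [folklore] -/
private theorem hasSum_tau_three_local {q : ℕ} (hq : q.Prime) {σ₀ : ℝ} (hσ₀ : 1 / 2 ≤ σ₀) :
    HasSum (fun n : ℕ => tau 3 (q ^ n) * (((q ^ n : ℕ) : ℝ)) ^ (-σ₀))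
      (1 / (1 - (q : ℝ) ^ (-σ₀)) ^ 3) ∧
    1 / (1 - (q : ℝ) ^ (-σ₀)) ^ 3 ≤ 1 + 192 * (q : ℝ) ^ (-σ₀) := by
  obtain ⟨hx0, hx1⟩ := prime_rpow_neg_le' hq hσ₀
  set x : ℝ := (q : ℝ) ^ (-σ₀) with hx
  have hxn : ‖x‖ < 1 := by rw [Real.norm_of_nonneg hx0]; linarith
  have hgeo := hasSum_choose_mul_geometric_of_norm_lt_one 2 hxn
  constructor
  · refine hgeo.congr_fun fun n => ?_
    rw [tau_three_prime_pow hq n]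
    have hpow : (((q ^ n : ℕ) : ℝ)) ^ (-σ₀) = x ^ n := by
      rw [hx, Nat.cast_pow, ← Real.rpow_natCast, ← Real.rpow_mul (Nat.cast_nonneg q), mul_comm,
        Real.rpow_mul (Nat.cast_nonneg q), Real.rpow_natCast]
    rw [hpow]
  · have h1x : 0 < 1 - x := by linarith
    have h1x3 : (1 / 4 : ℝ) ^ 3 ≤ (1 - x) ^ 3 := pow_le_pow_left₀ (by norm_num) (by linarith) 3
    rw [div_le_iff₀ (by positivity)]
    -- `1 ≤ (1 + 192x)(1−x)³`: from `(1−x)³ ≥ 1 − 3x` and `192x(1−x)³ ≥ 192x/64 = 3x`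
    have hx3 : 0 ≤ x ^ 2 * (3 - x) := mul_nonneg (sq_nonneg x) (by linarith only [hx1])
    have h2 : 1 - 3 * x ≤ (1 - x) ^ 3 := by nlinarith only [hx3]
    have h3 : 3 * x ≤ 192 * x * (1 - x) ^ 3 := by nlinarith only [h1x3, hx0]
    nlinarith only [h2, h3, hx0]

set_option maxHeartbeats 400000 in -- Euler-product bookkeeping over the `d₁`-factored numbers
/-- **`Σ_{h∈𝔫(d₁)} τ₃(h)h^{−σ₀} ≤ ∏_{q∣d₁}(1 + 192q^{−σ₀})`** (`σ₀ ≥ 1/2`): the Euler product of the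
multiplicative `h ↦ τ₃(h)h^{−σ₀}` over the `d₁`-factored numbers, factor by factor.
[cite: Zhang2022LandauSiegel, §15 (15.9) p.82] -/
theorem tsum_tau_three_nset_le (d₁ : ℕ) {σ₀ : ℝ} (hσ₀ : 1 / 2 ≤ σ₀) :
    ∑' h : ℕ, (Nat.factoredNumbers d₁.primeFactors).indicator
        (fun h : ℕ => tau 3 h * (h : ℝ) ^ (-σ₀)) h ≤
      ∏ q ∈ d₁.primeFactors, (1 + 192 * (q : ℝ) ^ (-σ₀)) := by
  set F : ℕ → ℝ := fun h => tau 3 h * (h : ℝ) ^ (-σ₀) with hF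
  have hF1 : F 1 = 1 := by
    simp only [hF, MeanSquareMajorant.tau_apply_one, Nat.cast_one, Real.one_rpow, mul_one]
  have hmul : ∀ {a b : ℕ}, Nat.Coprime a b → F (a * b) = F a * F b := fun {a b} hab => by
    simp only [hF]
    rw [(MeanSquareMajorant.isMultiplicative_tau 3).map_mul_of_coprime hab, Nat.cast_mul,
      Real.mul_rpow (Nat.cast_nonneg a) (Nat.cast_nonneg b)]
    ring
  have hF0 : ∀ h, 0 ≤ F h := fun h =>
    mul_nonneg (MeanSquareMajorant.tau_nonneg _ _) (Real.rpow_nonneg (Nat.cast_nonneg _) _)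
  have hsum : ∀ {q : ℕ}, q.Prime → Summable fun e : ℕ => ‖F (q ^ e)‖ := by
    intro q hq
    have h := (hasSum_tau_three_local hq hσ₀).1.summable
    refine h.congr fun e => ?_
    rw [Real.norm_of_nonneg (hF0 _)]
  obtain ⟨-, hhas⟩ :=
    EulerProduct.summable_and_hasSum_factoredNumbers_prod_filter_prime_tsum hF1 hmul hsum d₁.primeFactors
  have hfilter : d₁.primeFactors.filter (fun p => p.Prime) = d₁.primeFactors :=
    Finset.filter_true_of_mem fun p hp => Nat.prime_of_mem_primeFactors hp
  rw [hfilter] at hhas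
  rw [(hasSum_subtype_iff_indicator.mp hhas).tsum_eq]
  refine Finset.prod_le_prod (fun q hq => tsum_nonneg fun e => hF0 _) fun q hq => ?_
  have hqp := Nat.prime_of_mem_primeFactors hq
  obtain ⟨hloc, hle⟩ := hasSum_tau_three_local hqp hσ₀
  rw [hloc.tsum_eq]
  exact hle

end TauThree

/-! ## §2. `λ₁(n,s)`: holomorphy on `σ > 0` and the bound `∏_{q∣n}(1 + 15q^{−σ})` -/

section Lam

variable (c' : ℝ) {D : ℕ} (χ : DirichletCharacter ℂ D)

/-- `Re β₁ = 0`, `Re β₂ = 0`. [cite: Zhang2022LandauSiegel, §2 (2.13)] -/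
private theorem beta_re' (D : ℕ) : (beta1 c' D).re = 0 ∧ (beta2 c' D).re = 0 := by
  constructor
  · simp [beta1]
  · simp [beta2]

/-- `‖χ(q)q^{−w}‖ ≤ q^{−Re w}` for `q ≥ 1`. [folklore] -/
private theorem norm_chi_mul_cpow_le' {q : ℕ} (hq : 0 < q) (w : ℂ) :
    ‖χ (q : ZMod D) * (q : ℂ) ^ (-w)‖ ≤ (q : ℝ) ^ (-w.re) := by
  rw [norm_mul, Complex.norm_natCast_cpow_of_pos hq, Complex.neg_re]
  calc ‖χ (q : ZMod D)‖ * (q : ℝ) ^ (-w.re) ≤ 1 * (q : ℝ) ^ (-w.re) :=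
        mul_le_mul_of_nonneg_right (DirichletCharacter.norm_le_one χ _) (Real.rpow_nonneg (by positivity) _)
    _ = (q : ℝ) ^ (-w.re) := one_mul _

/-- **`λ₁(n,·)` is holomorphic at every `s` with `Re s > 0`** (finite product; `1 − χ(q)q^{−s} ≠ 0`).
[cite: Zhang2022LandauSiegel, §15 (15.10) p.82] -/
theorem differentiableAt_lam1 (n : ℕ) {s : ℂ} (hs : 0 < s.re) :
    DifferentiableAt ℂ (fun w => lam1 c' χ n w) s := by
  unfold lam1
  refine DifferentiableAt.fun_finsetProd fun q hq => ?_
  have hqp := Nat.prime_of_mem_primeFactors hq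
  have hq0 : (q : ℂ) ≠ 0 := by exact_mod_cast hqp.ne_zero
  have hnum1 : DifferentiableAt ℂ (fun w => 1 - χ (q : ZMod D) * (q : ℂ) ^ (-(w + beta1 c' D))) s :=
    (differentiableAt_const _).sub ((differentiableAt_const _).mul
      (((differentiableAt_id.add_const _).neg).const_cpow (Or.inl hq0)))
  have hnum2 : DifferentiableAt ℂ (fun w => 1 - χ (q : ZMod D) * (q : ℂ) ^ (-(w + beta2 c' D))) s :=
    (differentiableAt_const _).sub ((differentiableAt_const _).mul
      (((differentiableAt_id.add_const _).neg).const_cpow (Or.inl hq0)))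
  have hden : DifferentiableAt ℂ (fun w => 1 - χ (q : ZMod D) * (q : ℂ) ^ (-w)) s :=
    (differentiableAt_const _).sub ((differentiableAt_const _).mul
      ((differentiableAt_id.neg).const_cpow (Or.inl hq0)))
  refine (hnum1.mul hnum2).div hden ?_
  have hlt : ‖χ (q : ZMod D) * (q : ℂ) ^ (-s)‖ < 1 := by
    refine lt_of_le_of_lt (norm_chi_mul_cpow_le' χ hqp.pos s) ?_
    exact Real.rpow_lt_one_of_one_lt_of_neg (by exact_mod_cast hqp.one_lt) (by linarith)
  intro h
  have : ‖χ (q : ZMod D) * (q : ℂ) ^ (-s)‖ = 1 := by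
    rw [sub_eq_zero] at h; rw [← h, norm_one]
  linarith

/-- `(1 + x)²/(1 − x) ≤ 1 + 15x` for `0 ≤ x ≤ 3/4`. [folklore] -/
private theorem one_add_sq_div_one_sub_le {x : ℝ} (h0 : 0 ≤ x) (h1 : x ≤ 3 / 4) :
    (1 + x) ^ 2 / (1 - x) ≤ 1 + 15 * x := by
  have hpos : 0 < 1 - x := by linarith
  rw [div_le_iff₀ hpos]
  nlinarith

/-- **`|λ₁(n,s)| ≤ ∏_{q∣n}(1 + 15q^{−σ})`** for `σ = Re s ≥ 1/2` (each factor has modulus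
`≤ (1 + q^{−σ})²/(1 − q^{−σ})`, `Re β₁ = Re β₂ = 0`). [cite: Zhang2022LandauSiegel, §15 (15.10) p.82] -/
theorem norm_lam1_le_prod (n : ℕ) {s : ℂ} (hs : 1 / 2 ≤ s.re) :
    ‖lam1 c' χ n s‖ ≤ ∏ q ∈ n.primeFactors, (1 + 15 * (q : ℝ) ^ (-s.re)) := by
  unfold lam1
  rw [norm_prod]
  refine Finset.prod_le_prod (fun _ _ => norm_nonneg _) fun q hq => ?_
  have hqp := Nat.prime_of_mem_primeFactors hq
  obtain ⟨hx0, hx1⟩ := prime_rpow_neg_le' hqp hs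
  obtain ⟨hβ1, hβ2⟩ := beta_re' c' D
  set x : ℝ := (q : ℝ) ^ (-s.re) with hx
  have ha1 : ‖χ (q : ZMod D) * (q : ℂ) ^ (-(s + beta1 c' D))‖ ≤ x := by
    have h := norm_chi_mul_cpow_le' χ hqp.pos (s + beta1 c' D)
    rwa [Complex.add_re, hβ1, add_zero] at h
  have ha2 : ‖χ (q : ZMod D) * (q : ℂ) ^ (-(s + beta2 c' D))‖ ≤ x := by
    have h := norm_chi_mul_cpow_le' χ hqp.pos (s + beta2 c' D)
    rwa [Complex.add_re, hβ2, add_zero] at h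
  have hb : ‖χ (q : ZMod D) * (q : ℂ) ^ (-s)‖ ≤ x := norm_chi_mul_cpow_le' χ hqp.pos s
  have hn1 : ‖1 - χ (q : ZMod D) * (q : ℂ) ^ (-(s + beta1 c' D))‖ ≤ 1 + x := by
    calc ‖1 - χ (q : ZMod D) * (q : ℂ) ^ (-(s + beta1 c' D))‖
        ≤ ‖(1 : ℂ)‖ + ‖χ (q : ZMod D) * (q : ℂ) ^ (-(s + beta1 c' D))‖ := norm_sub_le _ _
      _ ≤ 1 + x := by rw [norm_one]; gcongr
  have hn2 : ‖1 - χ (q : ZMod D) * (q : ℂ) ^ (-(s + beta2 c' D))‖ ≤ 1 + x := by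
    calc ‖1 - χ (q : ZMod D) * (q : ℂ) ^ (-(s + beta2 c' D))‖
        ≤ ‖(1 : ℂ)‖ + ‖χ (q : ZMod D) * (q : ℂ) ^ (-(s + beta2 c' D))‖ := norm_sub_le _ _
      _ ≤ 1 + x := by rw [norm_one]; gcongr
  have hden : 1 - x ≤ ‖1 - χ (q : ZMod D) * (q : ℂ) ^ (-s)‖ := by
    have h := norm_sub_norm_le (1 : ℂ) (χ (q : ZMod D) * (q : ℂ) ^ (-s))
    rw [norm_one] at h
    linarith
  have hden0 : 0 < 1 - x := by linarith
  rw [norm_div, norm_mul]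
  calc ‖1 - χ (q : ZMod D) * (q : ℂ) ^ (-(s + beta1 c' D))‖ *
        ‖1 - χ (q : ZMod D) * (q : ℂ) ^ (-(s + beta2 c' D))‖ / ‖1 - χ (q : ZMod D) * (q : ℂ) ^ (-s)‖
      ≤ (1 + x) ^ 2 / (1 - x) := by
        rw [div_le_div_iff₀ (lt_of_lt_of_le hden0 hden) hden0]
        calc ‖1 - χ (q : ZMod D) * (q : ℂ) ^ (-(s + beta1 c' D))‖ *
              ‖1 - χ (q : ZMod D) * (q : ℂ) ^ (-(s + beta2 c' D))‖ * (1 - x)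
            ≤ (1 + x) ^ 2 * (1 - x) := by
              rw [pow_two]
              exact mul_le_mul_of_nonneg_right (mul_le_mul hn1 hn2 (norm_nonneg _) (by linarith))
                hden0.le
          _ ≤ (1 + x) ^ 2 * ‖1 - χ (q : ZMod D) * (q : ℂ) ^ (-s)‖ :=
              mul_le_mul_of_nonneg_left hden (by positivity)
    _ ≤ 1 + 15 * x := one_add_sq_div_one_sub_le hx0 hx1

end Lam

/-! ## §3. `L(s+β,χ)` on the contour region and the pointwise bound for `G` -/

section GBound

variable (c' : ℝ) {D : ℕ} [NeZero D] (χ : DirichletCharacter ℂ D)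

/-- **`‖L(s+β,χ)‖ ≤ 2𝓛⁹` on the contour region** for a purely imaginary shift with `‖β‖ ≤ 1` (`𝓛 ≥ 8`,
`χ ≠ χ₀`): `ζ(1+α)`-bound right of `1+α` (`Lemma84.norm_LFunction_le_right'`), `3 + log D + log(|s+β|+1)`
on `σ ≥ 1` (`Section8Floor.norm_LFunction_le_right`), the convexity-type bound on `1 − 1/(16𝓛) ≤ σ < 1`
(`Lemma82.norm_LFunction_le_left`, `(D³)^{1/(16𝓛)} ≤ e`). [cite: Zhang2022LandauSiegel, §15 p.82 (u021)] -/
theorem norm_LFunction_add_le (hχ : χ ≠ 1) (hℓ8 : 8 ≤ ell D) {β : ℂ} (hβre : β.re = 0)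
    (hβ : ‖β‖ ≤ 1) {s : ℂ} (hs1 : 1 - 1 / (16 * ell D) ≤ s.re) (hs2 : s.re ≤ 2)
    (hs3 : |s.im| ≤ (D : ℝ) + 1 ∨ 1 + alpha D ≤ s.re) :
    ‖χ.LFunction (s + β)‖ ≤ 2 * ell D ^ 9 := by
  have hℓ4 : 4 ≤ ell D := by linarith only [hℓ8]
  have hℓ1 : 1 ≤ ell D := by linarith only [hℓ8]
  have hℓ0 : 0 < ell D := by linarith only [hℓ8]
  obtain ⟨hD3r, hD3, hDexp, hα0, hαℓ, hℓinv, hαlogP, hlogP, hαval⟩ := DeltaContourShift.param_facts hℓ4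
  have hre : (s + β).re = s.re := by rw [Complex.add_re, hβre, add_zero]
  have hℓ9 : (1 : ℝ) ≤ ell D ^ 9 := one_le_pow₀ hℓ1
  have hbig : 100 * ell D ≤ ell D ^ 9 := by
    have h8 : (8 : ℝ) ^ 8 ≤ ell D ^ 8 := pow_le_pow_left₀ (by norm_num) hℓ8 8
    have h100 : (100 : ℝ) ≤ ell D ^ 8 := le_trans (by norm_num) h8
    calc 100 * ell D ≤ ell D ^ 8 * ell D := mul_le_mul_of_nonneg_right h100 hℓ0.le
      _ = ell D ^ 9 := by ring
  have h16 : 1 / (16 * ell D) ≤ 1 / 16 := by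
    apply div_le_div_of_nonneg_left (by norm_num) (by norm_num); linarith only [hℓ1]
  by_cases hfar : 1 + alpha D ≤ s.re
  · have h := Lemma84.norm_LFunction_le_right' χ hα0 (s := s + β) (by rw [hre]; exact hfar)
    refine h.trans ?_
    have hsplit : (1 + alpha D) / alpha D = 1 / alpha D + 1 := by field_simp
    rw [hsplit, hαval, one_div_div]
    have h1 : ell D ^ 9 / π ≤ ell D ^ 9 := div_le_self (by positivity) (by linarith only [Real.pi_gt_three])
    linarith only [h1, hℓ9]
  have ht : |s.im| ≤ (D : ℝ) + 1 := by
    rcases hs3 with h | h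
    · exact h
    · exact absurd h hfar
  have hnorm : ‖s + β‖ + 1 ≤ (D : ℝ) + 5 := by
    have h1 : ‖s‖ ≤ |s.re| + |s.im| := Complex.norm_le_abs_re_add_abs_im s
    have h2 : |s.re| ≤ 2 := by
      rw [abs_le]; constructor <;> linarith only [hs1, hs2, h16]
    have h3 : ‖s + β‖ ≤ ‖s‖ + ‖β‖ := norm_add_le _ _
    linarith only [h1, h2, h3, ht, hβ]
  have hD5 : (D : ℝ) + 5 ≤ (D : ℝ) ^ 3 := by
    have hD0 : (0 : ℝ) ≤ (D : ℝ) := Nat.cast_nonneg D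
    have h33 : (3 : ℝ) * 3 ≤ (D : ℝ) * D := mul_le_mul hD3r hD3r (by norm_num) hD0
    have h9D : 9 * (D : ℝ) ≤ (D : ℝ) * D * D := mul_le_mul_of_nonneg_right (by linarith only [h33]) hD0
    have : (D : ℝ) ^ 3 = (D : ℝ) * D * D := by ring
    rw [this]; linarith only [h9D, hD3r]
  have hlog5 : Real.log (‖s + β‖ + 1) ≤ 3 * ell D := by
    have hpos : 0 < ‖s + β‖ + 1 := by positivity
    calc Real.log (‖s + β‖ + 1) ≤ Real.log ((D : ℝ) ^ 3) := Real.log_le_log hpos (hnorm.trans hD5)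
      _ = 3 * ell D := by rw [Real.log_pow, ell]; norm_num
  have hlogD : Real.log (D : ℝ) = ell D := rfl
  by_cases hσ1 : 1 ≤ s.re
  · have h := Section8Floor.norm_LFunction_le_right χ hχ (s := s + β) (by rw [hre]; exact hσ1)
    rw [hlogD] at h
    linarith only [h, hlog5, hbig, hℓ1]
  · rw [not_le] at hσ1
    have h := Lemma82.norm_LFunction_le_left χ hχ (s := s + β)
      (by rw [hre]; linarith only [hs1, h16]) (by rw [hre]; exact hσ1.le)
    rw [hlogD, hre] at h
    refine h.trans ?_
    have hB1 : (1 : ℝ) ≤ (D : ℝ) * (‖s + β‖ + 1) := by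
      have : (1 : ℝ) ≤ ‖s + β‖ + 1 := by linarith [norm_nonneg (s + β)]
      nlinarith
    have hB3 : (D : ℝ) * (‖s + β‖ + 1) ≤ (D : ℝ) ^ 3 * (D : ℝ) ^ 3 := by
      have h1 : (D : ℝ) ≤ (D : ℝ) ^ 3 := by nlinarith
      exact mul_le_mul h1 (hnorm.trans hD5) (by positivity) (by positivity)
    have hexp : 1 - s.re ≤ 1 / (16 * ell D) := by linarith
    have hpow : ((D : ℝ) * (‖s + β‖ + 1)) ^ (1 - s.re) ≤ 3 := by
      calc ((D : ℝ) * (‖s + β‖ + 1)) ^ (1 - s.re)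
          ≤ ((D : ℝ) * (‖s + β‖ + 1)) ^ (1 / (16 * ell D)) :=
            Real.rpow_le_rpow_of_exponent_le hB1 hexp
        _ ≤ ((D : ℝ) ^ 3 * (D : ℝ) ^ 3) ^ (1 / (16 * ell D)) :=
            Real.rpow_le_rpow (by positivity) hB3 (by positivity)
        _ = Real.exp (6 / 16) := by
            rw [← pow_add, hDexp, ← Real.exp_nat_mul, ← Real.exp_mul]
            congr 1
            push_cast
            field_simp
        _ ≤ 3 := by
            have := Real.exp_one_lt_d9
            have h1 : Real.exp (6 / 16) ≤ Real.exp 1 := Real.exp_le_exp.mpr (by norm_num)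
            linarith only [this, h1]
    have hlogpart : 4 + ell D + Real.log (‖s + β‖ + 1) ≤ 4 + 4 * ell D := by
      linarith only [hlog5]
    have h0 : 0 ≤ 4 + ell D + Real.log (‖s + β‖ + 1) := by
      have : 0 ≤ Real.log (‖s + β‖ + 1) :=
        Real.log_nonneg (by linarith only [norm_nonneg (s + β)])
      linarith only [this, hℓ0]
    calc ((D : ℝ) * (‖s + β‖ + 1)) ^ (1 - s.re) * (4 + ell D + Real.log (‖s + β‖ + 1))
        ≤ 3 * (4 + 4 * ell D) := mul_le_mul hpow hlogpart h0 (by norm_num)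
      _ ≤ 2 * ell D ^ 9 := by linarith only [hbig, hℓ1]

/-- `‖β₁‖ ≤ 1` and `‖β₂‖ ≤ 1` once `𝓛 ≥ 4`, `𝓛 ≥ 2 + 5|c′|` (`β₁ = iα(1 − 5c′α𝓛)`, `β₂ = 2iα(1 + c′α𝓛)`,
`α ≤ 𝓛⁻¹`). [cite: Zhang2022LandauSiegel, §2 (2.13)] -/
theorem norm_beta_le_one {D : ℕ} (hℓ4 : 4 ≤ ell D) (hℓc : 2 + 5 * |c'| ≤ ell D) :
    ‖beta1 c' D‖ ≤ 1 ∧ ‖beta2 c' D‖ ≤ 1 := by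
  obtain ⟨-, -, -, hα0, hαℓ, -, -, -, -⟩ := DeltaContourShift.param_facts hℓ4
  have hℓ0 : 0 < ell D := by linarith
  have hαℓ1 : alpha D * ell D ≤ 1 := by
    calc alpha D * ell D ≤ (ell D)⁻¹ * ell D := mul_le_mul_of_nonneg_right hαℓ hℓ0.le
      _ = 1 := inv_mul_cancel₀ hℓ0.ne'
  have hcαℓ : |c'| * (alpha D * ell D) ≤ |c'| := by
    calc |c'| * (alpha D * ell D) ≤ |c'| * 1 := by gcongr
      _ = |c'| := mul_one _
  constructor
  · rw [beta1]
    rw [norm_mul, norm_mul, Complex.norm_I, one_mul, Complex.norm_real, Complex.norm_real,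
      Real.norm_eq_abs, Real.norm_eq_abs, abs_of_pos hα0]
    have h1 : |1 - 5 * c' * alpha D * ell D| ≤ 1 + 5 * |c'| := by
      calc |1 - 5 * c' * alpha D * ell D| ≤ |(1 : ℝ)| + |5 * c' * alpha D * ell D| := abs_sub _ _
        _ = 1 + 5 * (|c'| * (alpha D * ell D)) := by
            rw [abs_one, show 5 * c' * alpha D * ell D = 5 * (c' * (alpha D * ell D)) by ring, abs_mul,
              abs_mul, abs_of_nonneg (by positivity : (0 : ℝ) ≤ alpha D * ell D)]
            norm_num
        _ ≤ 1 + 5 * |c'| := by linarith only [hcαℓ]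
    calc alpha D * |1 - 5 * c' * alpha D * ell D| ≤ (ell D)⁻¹ * (1 + 5 * |c'|) :=
          mul_le_mul hαℓ h1 (abs_nonneg _) (by positivity)
      _ ≤ (ell D)⁻¹ * ell D := by gcongr; linarith only [hℓc]
      _ = 1 := inv_mul_cancel₀ hℓ0.ne'
  · rw [beta2]
    rw [norm_mul, norm_mul, norm_mul, Complex.norm_I, mul_one, Complex.norm_real, Complex.norm_real,
      Real.norm_eq_abs, Real.norm_eq_abs, abs_of_pos hα0, Complex.norm_ofNat]
    have h1 : |1 + c' * alpha D * ell D| ≤ 1 + |c'| := by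
      calc |1 + c' * alpha D * ell D| ≤ |(1 : ℝ)| + |c' * alpha D * ell D| := abs_add_le _ _
        _ = 1 + |c'| * (alpha D * ell D) := by
            rw [abs_one, show c' * alpha D * ell D = c' * (alpha D * ell D) by ring, abs_mul,
              abs_of_nonneg (by positivity : (0 : ℝ) ≤ alpha D * ell D)]
        _ ≤ 1 + |c'| := by linarith only [hcαℓ]
    calc 2 * alpha D * |1 + c' * alpha D * ell D| ≤ 2 * (ell D)⁻¹ * (1 + |c'|) := by gcongr
      _ = (ell D)⁻¹ * (2 + 2 * |c'|) := by ring
      _ ≤ (ell D)⁻¹ * ell D := by gcongr; linarith only [hℓc, abs_nonneg c']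
      _ = 1 := inv_mul_cancel₀ hℓ0.ne'

/-- `exp(2C(log(2𝓛) + 4) + 4C𝓛⁹/D²) ≤ (2𝓛)^{2C}·e^{12C}` for `𝓛⁹ ≤ D²`. [folklore] -/
private theorem exp_weight_le' {D : ℕ} (hℓ1 : 1 ≤ ell D) (hℓD : ell D ^ 9 ≤ (D : ℝ) ^ 2) (k : ℕ) :
    Real.exp (2 * (k : ℝ) * (Real.log (2 * Real.log D) + 4) + 4 * (k : ℝ) * Real.log D ^ 9 / (D : ℝ) ^ 2)
      ≤ (2 * ell D) ^ (2 * k) * Real.exp (12 * k) := by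
  have hℓ0 : 0 < ell D := by linarith
  have hlD : Real.log (D : ℝ) = ell D := rfl
  rw [hlD]
  have hD2 : 0 < (D : ℝ) ^ 2 := lt_of_lt_of_le (by positivity) hℓD
  have hratio : ell D ^ 9 / (D : ℝ) ^ 2 ≤ 1 := by
    rw [div_le_one hD2]; exact hℓD
  have hk0 : (0 : ℝ) ≤ k := Nat.cast_nonneg k
  have h1 : 2 * (k : ℝ) * (Real.log (2 * ell D) + 4) + 4 * (k : ℝ) * ell D ^ 9 / (D : ℝ) ^ 2 ≤
      (2 * k : ℕ) * Real.log (2 * ell D) + 12 * k := by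
    have : 4 * (k : ℝ) * ell D ^ 9 / (D : ℝ) ^ 2 = 4 * k * (ell D ^ 9 / (D : ℝ) ^ 2) := by ring
    rw [this]
    push_cast
    nlinarith [hratio, hk0]
  calc Real.exp (2 * (k : ℝ) * (Real.log (2 * ell D) + 4) + 4 * (k : ℝ) * ell D ^ 9 / (D : ℝ) ^ 2)
      ≤ Real.exp ((2 * k : ℕ) * Real.log (2 * ell D) + 12 * k) := Real.exp_le_exp.mpr h1
    _ = (2 * ell D) ^ (2 * k) * Real.exp (12 * k) := by
        rw [Real.exp_add, Real.exp_nat_mul, Real.exp_log (by positivity)]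

set_option exponentiation.threshold 2048 in -- the constant 2⁴¹⁶ = 2³⁸⁴·2³⁰·4
/-- **Pointwise polynomial bound for `G = κ̃₁·λ₁·L(·+β₁,χ)L(·+β₂,χ)` on the contour region**: for
`𝓛 ≥ max(8, 2 + 5|c′|)`, `𝓛⁹ ≤ D²`, `d₁, m ≥ 1` with `log d₁, log(d₁m) ≤ 𝓛⁹`, and `s` with
`1 − 1/(16𝓛) ≤ σ ≤ 2`, `|t| ≤ D + 1 ∨ σ ≥ 1 + α`:
`‖κ̃₁(d₁;m,s)λ₁(d₁m,s)L(s+β₁,χ)L(s+β₂,χ)‖ ≤ τ₃(d₁)·2⁴¹⁶e²⁴⁸⁴𝓛⁴³²` — uniformly in `m` and `t`.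
[cite: Zhang2022LandauSiegel, §15 p.82 (u021)] -/
theorem norm_G15_le (hχ : χ ≠ 1) (hℓ8 : 8 ≤ ell D) (hℓc : 2 + 5 * |c'| ≤ ell D)
    (hℓD : ell D ^ 9 ≤ (D : ℝ) ^ 2) {d₁ m : ℕ} (hd₁ : d₁ ≠ 0) (hm : m ≠ 0)
    (hd₁P : Real.log d₁ ≤ ell D ^ 9) (hnP : Real.log ((d₁ * m : ℕ) : ℝ) ≤ ell D ^ 9)
    {s : ℂ} (hs1 : 1 - 1 / (16 * ell D) ≤ s.re) (hs2 : s.re ≤ 2)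
    (hs3 : |s.im| ≤ (D : ℝ) + 1 ∨ 1 + alpha D ≤ s.re) :
    ‖kappaTilde1 c' χ d₁ m s * lam1 c' χ (d₁ * m) s *
        (χ.LFunction (s + beta1 c' D) * χ.LFunction (s + beta2 c' D))‖ ≤
      tau 3 d₁ * (2 ^ 416 * Real.exp 2484 * ell D ^ 432) := by
  have hℓ4 : 4 ≤ ell D := by linarith only [hℓ8]
  have hℓ1 : 1 ≤ ell D := by linarith only [hℓ8]
  have hℓ0 : 0 < ell D := by linarith only [hℓ8]
  have hlog2 : 2 ≤ Real.log (D : ℝ) := by show 2 ≤ ell D; linarith only [hℓ8]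
  set σ₀ : ℝ := 1 - 1 / (16 * ell D) with hσ₀
  have h16 : 1 / (16 * ell D) ≤ 1 / 16 := by
    apply div_le_div_of_nonneg_left (by norm_num) (by norm_num); linarith only [hℓ1]
  have hσ₀half : 1 / 2 ≤ σ₀ := by rw [hσ₀]; linarith only [h16]
  have hσ₀pos : 0 < σ₀ := by linarith only [hσ₀half]
  have hη0 : (0 : ℝ) ≤ 1 / (16 * ell D) := by positivity
  have hηL : 2 * (1 / (16 * ell D)) * Real.log D ≤ 1 / 4 := by
    show 2 * (1 / (16 * ell D)) * ell D ≤ 1 / 4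
    field_simp; norm_num
  have hτ0 : 0 ≤ tau 3 d₁ := MeanSquareMajorant.tau_nonneg _ _
  -- `κ̃₁`
  have hkap : ‖kappaTilde1 c' χ d₁ m s‖ ≤ tau 3 d₁ * ((2 * ell D) ^ 384 * Real.exp 2304) := by
    have h1 := norm_kappaTilde1_le c' χ hd₁ m hσ₀pos s hs1
    have h2 := tsum_tau_three_nset_le d₁ hσ₀half
    have h3 := Lemma84.prod_primeFactors_le (D := D) (n := d₁) hlog2 hd₁ hd₁P (C := 192) (by norm_num)
      hη0 hηL (σ := σ₀) le_rfl
    have h4 := exp_weight_le' hℓ1 hℓD 192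
    refine h1.trans (mul_le_mul_of_nonneg_left (h2.trans (h3.trans ?_)) hτ0)
    have := h4
    norm_num at this ⊢
    exact this
  -- `λ₁`
  have hlam : ‖lam1 c' χ (d₁ * m) s‖ ≤ (2 * ell D) ^ 30 * Real.exp 180 := by
    have h1 := norm_lam1_le_prod c' χ (d₁ * m) (le_trans hσ₀half hs1)
    have hmono : ∏ q ∈ (d₁ * m).primeFactors, (1 + 15 * (q : ℝ) ^ (-s.re)) ≤
        ∏ q ∈ (d₁ * m).primeFactors, (1 + 15 * (q : ℝ) ^ (-σ₀)) := by
      refine Finset.prod_le_prod (fun q hq => by positivity) fun q hq => ?_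
      have hq1 : (1 : ℝ) ≤ q := by exact_mod_cast (Nat.prime_of_mem_primeFactors hq).one_lt.le
      have : (q : ℝ) ^ (-s.re) ≤ (q : ℝ) ^ (-σ₀) :=
        Real.rpow_le_rpow_of_exponent_le hq1 (by linarith only [hs1])
      linarith only [this]
    have h3 := Lemma84.prod_primeFactors_le (D := D) (n := d₁ * m) hlog2 (mul_ne_zero hd₁ hm) hnP
      (C := 15) (by norm_num) hη0 hηL (σ := σ₀) le_rfl
    have h4 := exp_weight_le' hℓ1 hℓD 15
    refine h1.trans (hmono.trans (h3.trans ?_))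
    have := h4
    norm_num at this ⊢
    exact this
  -- `L(s+β₁)L(s+β₂)`
  obtain ⟨hβ1, hβ2⟩ := norm_beta_le_one c' hℓ4 hℓc
  obtain ⟨hβ1re, hβ2re⟩ := beta_re' c' D
  have hL1 := norm_LFunction_add_le χ hχ hℓ8 hβ1re hβ1 hs1 hs2 hs3
  have hL2 := norm_LFunction_add_le χ hχ hℓ8 hβ2re hβ2 hs1 hs2 hs3
  rw [norm_mul, norm_mul, norm_mul]
  calc ‖kappaTilde1 c' χ d₁ m s‖ * ‖lam1 c' χ (d₁ * m) s‖ *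
        (‖χ.LFunction (s + beta1 c' D)‖ * ‖χ.LFunction (s + beta2 c' D)‖)
      ≤ tau 3 d₁ * ((2 * ell D) ^ 384 * Real.exp 2304) * ((2 * ell D) ^ 30 * Real.exp 180) *
          ((2 * ell D ^ 9) * (2 * ell D ^ 9)) := by
        gcongr
    _ = tau 3 d₁ * (2 ^ 416 * (Real.exp 2304 * Real.exp 180) * ell D ^ 432) := by ring
    _ = tau 3 d₁ * (2 ^ 416 * Real.exp 2484 * ell D ^ 432) := by rw [← Real.exp_add]; norm_num

/-- **`G = κ̃₁·λ₁·L(·+β₁,χ)L(·+β₂,χ)` is holomorphic on `σ > 9/10`** (`d₁ ≥ 1`, `χ ≠ χ₀`).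
[cite: Zhang2022LandauSiegel, §15 p.82 (u021)] -/
theorem differentiableOn_G15 (hχ : χ ≠ 1) {d₁ : ℕ} (hd₁ : d₁ ≠ 0) (m : ℕ) :
    DifferentiableOn ℂ (fun s => kappaTilde1 c' χ d₁ m s * lam1 c' χ (d₁ * m) s *
      (χ.LFunction (s + beta1 c' D) * χ.LFunction (s + beta2 c' D))) {s : ℂ | 9 / 10 < s.re} := by
  have h1 := differentiableOn_kappaTilde1 c' χ hd₁ m (by norm_num : (0 : ℝ) < 9 / 10)
  have hL : Differentiable ℂ χ.LFunction := DirichletCharacter.differentiable_LFunction hχ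
  have h3 : Differentiable ℂ fun s => χ.LFunction (s + beta1 c' D) * χ.LFunction (s + beta2 c' D) :=
    (hL.comp (differentiable_id.add_const _)).mul (hL.comp (differentiable_id.add_const _))
  intro s hs
  have hs0 : 0 < s.re := by have : 9 / 10 < s.re := hs; linarith
  exact ((h1 s hs).mul (differentiableAt_lam1 c' χ (d₁ * m) hs0).differentiableWithinAt).mul
    (h3 s).differentiableWithinAt

end GBound

/-! ## §4. The node: master form and as printed -/

section Main

set_option exponentiation.threshold 2048 in
set_option maxHeartbeats 800000 in -- long instantiation of the engine (G, M, y) plus bookkeeping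
/-- **u021, master form (all `l₂` with `l₂T ≤ Dpk`).** For every `c′` there is `C` such that for all
large `D`, every real primitive `χ (mod D)` with (A), `p ∼ P`, `d₁, d₂, k, l₂ ≥ 1` with `d₁d₂k < 2P₄` and
`l₂T ≤ Dpk`:
`‖Σ_{(l₁,d₂k)=1} κ₁(d₁l₁)χ(l₁)Δ(l₁l₂/(Dpk)) − 𝓡₁*·(Dpk/l₂)·κ̃₁(d₁;d₂k)λ₁(d₁d₂k)‖ ≤ C·τ₃(d₁)·𝓛⁻¹⁵⁰⁰·Dpk/l₂`
— (15.8) (`eq15_8_holds`) + u020 (`step15_u020_holds`) + the engine `DeltaContourShift.deltaContourShift`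
with `G = κ̃₁λ₁L(·+β₁,χ)L(·+β₂,χ)`, `M = τ₃(d₁)2⁴¹⁶e²⁴⁸⁴𝓛⁴³²`. [cite: Zhang2022LandauSiegel, §15 p.82 (u021)] -/
theorem step15_u021_master (c' : ℝ) : ∃ C : ℝ, 0 ≤ C ∧ ForAllLarge fun D _ χ => AssumptionA D χ →
    ∀ p ∈ primeWindow D, ∀ d₁ d₂ k l₂ : ℕ, 0 < d₁ → 0 < d₂ → 0 < k → 0 < l₂ →
      ((d₁ * d₂ * k : ℕ) : ℝ) < 2 * P4 D → (l₂ : ℝ) * bigT D ≤ (D : ℝ) * p * k →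
      ‖(∑' l₁ : ℕ, if Nat.Coprime l₁ (d₂ * k) then
              kappa1 c' D (d₁ * l₁) * χ (l₁ : ZMod D) *
                DeltaW D (((l₁ * l₂ : ℕ) : ℝ) / ((D : ℝ) * p * k)) else 0) -
            calR1star c' χ * ((((D : ℝ) * p * k / l₂ : ℝ)) : ℂ) *
              kappaTilde1 c' χ d₁ (d₂ * k) 1 * lam1 c' χ (d₁ * d₂ * k) 1‖ ≤
        C * tau 3 d₁ * (ell D ^ 1500)⁻¹ * ((D : ℝ) * p * k / l₂) := by
  obtain ⟨C, hC0, D₀, hE⟩ := DeltaContourShift.deltaContourShift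
  obtain ⟨D₁, h158⟩ := eq15_8_holds c'
  obtain ⟨D₂, hP4⟩ := Typed.Sec14.exists_two_mul_P4_le_bigP
  obtain ⟨D₃, hℓ9D⟩ := exists_mul_ell_pow_le 9 (zero_le_one)
  obtain ⟨D₄, hD₄⟩ := exists_forall_le_ell (8 + 5 * |c'|)
  refine ⟨C * (2 ^ 416 * Real.exp 2484), by positivity, max (max D₀ D₁) (max (max D₂ D₃) D₄),
    fun D _ χ hD hq hprim hA p hp d₁ d₂ k l₂ hd₁ hd₂ hk hl₂ hdk hlT => ?_⟩
  have hD₀ : D₀ ≤ D := le_trans (le_trans (le_max_left _ _) (le_max_left _ _)) hD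
  have hD₁ : D₁ ≤ D := le_trans (le_trans (le_max_right _ _) (le_max_left _ _)) hD
  have hD₂ : D₂ ≤ D := le_trans (le_trans (le_trans (le_max_left _ _) (le_max_left _ _)) (le_max_right _ _)) hD
  have hD₃ : D₃ ≤ D := le_trans (le_trans (le_trans (le_max_right _ _) (le_max_left _ _)) (le_max_right _ _)) hD
  have hD₄' : D₄ ≤ D := le_trans (le_trans (le_max_right _ _) (le_max_right _ _)) hD
  have hL := hD₄ D hD₄'
  have habs : 0 ≤ 5 * |c'| := by positivity
  have hℓ8 : 8 ≤ ell D := by linarith only [hL, habs]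
  have hℓc : 2 + 5 * |c'| ≤ ell D := by linarith only [hL, habs]
  have hℓ4 : 4 ≤ ell D := by linarith only [hℓ8]
  have hℓ1 : 1 ≤ ell D := by linarith only [hℓ8]
  obtain ⟨hD3r, hD3, -⟩ := DeltaContourShift.param_facts hℓ4
  have hℓD : ell D ^ 9 ≤ (D : ℝ) ^ 2 := by
    have h1 : 1 * ell D ^ 9 ≤ D := hℓ9D D hD₃
    have h2 : (D : ℝ) ≤ (D : ℝ) ^ 2 := by nlinarith only [hD3r]
    linarith only [h1, h2]
  have hχ1 : χ ≠ 1 := ne_one_of_isPrimitive_of_three_le hprim hD3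
  obtain ⟨hTy, hlogy, hd₁P, hnP⟩ :=
    Typed.Section16A.params_u015 hℓ8 (hP4 D hD₂) hp hd₁ hd₂ hk hl₂ hlT hdk
  have hd₁0 : d₁ ≠ 0 := by omega
  have hm0 : d₂ * k ≠ 0 := Nat.mul_ne_zero (by omega) (by omega)
  have hp0 : (0 : ℝ) < p := pos_of_mem_primeWindow hp
  -- the factor `G` and its bound `M`
  set y : ℝ := (D : ℝ) * p * k / l₂ with hy
  set G : ℂ → ℂ := fun s => kappaTilde1 c' χ d₁ (d₂ * k) s * lam1 c' χ (d₁ * (d₂ * k)) s *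
    (χ.LFunction (s + beta1 c' D) * χ.LFunction (s + beta2 c' D)) with hG
  set M : ℝ := tau 3 d₁ * (2 ^ 416 * Real.exp 2484 * ell D ^ 432) with hM
  have hτ0 : 0 ≤ tau 3 d₁ := MeanSquareMajorant.tau_nonneg _ _
  have hM0 : 0 ≤ M := by positivity
  have hGdiff : DifferentiableOn ℂ G {s : ℂ | 9 / 10 < s.re} := differentiableOn_G15 c' χ hχ1 hd₁0 (d₂ * k)
  have hGM : ∀ s : ℂ, 1 - 1 / (16 * ell D) ≤ s.re → s.re ≤ 2 →
      (|s.im| ≤ (D : ℝ) + 1 ∨ 1 + alpha D ≤ s.re) → ‖G s‖ ≤ M := fun s h1 h2 h3 =>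
    norm_G15_le c' χ hχ1 hℓ8 hℓc hℓD hd₁0 hm0 hd₁P hnP h1 h2 h3
  have hEng := hE D χ hD₀ hq hprim hA G M hM0 hGdiff hGM y hTy hlogy
  -- (15.8) and u020: the left side is the engine's line integral
  have hEq := h158 D χ hD₁ hq hprim p hp d₁ d₂ k l₂ hd₁ hd₂ hk hl₂
  have hint : ∀ t : ℝ,
      (∑' l₁ : ℕ, if Nat.Coprime l₁ (d₂ * k) then
          kappa1 c' D (d₁ * l₁) * χ (l₁ : ZMod D) / (l₁ : ℂ) ^ (2 + t * I : ℂ) else 0) *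
        ((((D : ℝ) * p * k / l₂ : ℝ)) : ℂ) ^ (2 + t * I : ℂ) * deltaW D (2 + t * I) =
      G (2 + t * I) * (χ.LFunction (2 + t * I))⁻¹ * (y : ℂ) ^ (2 + t * I : ℂ) * deltaW D (2 + t * I) := by
    intro t
    obtain ⟨-, h20⟩ := step15_u020_holds c' D χ d₁ d₂ k (2 + t * I) hd₁ hd₂ hk (by simp)
    rw [h20, hG, hy, Nat.mul_assoc]
    simp only [div_eq_mul_inv]
    ring
  have hfun : (fun t : ℝ => (∑' l₁ : ℕ, if Nat.Coprime l₁ (d₂ * k) then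
          kappa1 c' D (d₁ * l₁) * χ (l₁ : ZMod D) / (l₁ : ℂ) ^ (2 + t * I : ℂ) else 0) *
        ((((D : ℝ) * p * k / l₂ : ℝ)) : ℂ) ^ (2 + t * I : ℂ) * deltaW D (2 + t * I)) =
      fun t : ℝ => G (2 + t * I) * (χ.LFunction (2 + t * I))⁻¹ * (y : ℂ) ^ (2 + t * I : ℂ) *
        deltaW D (2 + t * I) := funext hint
  rw [hEq, hfun]
  -- the main term
  have hmain : calR1star c' χ * ((y : ℝ) : ℂ) * kappaTilde1 c' χ d₁ (d₂ * k) 1 *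
      lam1 c' χ (d₁ * d₂ * k) 1 = G 1 * (y : ℂ) * deltaW D 1 / deriv χ.LFunction 1 := by
    rw [hG, calR1star, Nat.mul_assoc]
    simp only []
    ring
  rw [hmain]
  refine hEng.trans ?_
  rw [hM]
  have hpow : ell D ^ 432 * (ell D ^ 2000)⁻¹ ≤ (ell D ^ 1500)⁻¹ := by
    have h2000 : 0 < ell D ^ 2000 := by positivity
    have h1500 : 0 < ell D ^ 1500 := by positivity
    rw [← div_eq_mul_inv, div_le_iff₀ h2000, ← div_eq_inv_mul, le_div_iff₀ h1500, ← pow_add]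
    exact pow_le_pow_right₀ hℓ1 (by norm_num)
  calc C * (tau 3 d₁ * (2 ^ 416 * Real.exp 2484 * ell D ^ 432)) * y * (ell D ^ 2000)⁻¹
      = C * (2 ^ 416 * Real.exp 2484) * tau 3 d₁ * (ell D ^ 432 * (ell D ^ 2000)⁻¹) * y := by ring
    _ ≤ C * (2 ^ 416 * Real.exp 2484) * tau 3 d₁ * (ell D ^ 1500)⁻¹ * y := by gcongr

/-- `(ℓ^1500)⁻¹ ≤ α¹⁰⁰ = π¹⁰⁰/ℓ⁹⁰⁰` for `ℓ ≥ 4`. [cite: Zhang2022LandauSiegel, §2 (2.10)] -/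
private theorem inv_pow_le_alpha_pow' {D : ℕ} (hℓ4 : 4 ≤ ell D) :
    (ell D ^ 1500)⁻¹ ≤ alpha D ^ 100 := by
  have hℓ1 : 1 ≤ ell D := by linarith only [hℓ4]
  obtain ⟨-, -, -, -, -, -, -, -, hαval⟩ := DeltaContourShift.param_facts hℓ4
  rw [hαval, div_pow]
  have h900 : 0 < ell D ^ 900 := by positivity
  have hπ : (1 : ℝ) ≤ π ^ 100 := one_le_pow₀ (by linarith only [Real.pi_gt_three])
  have hpow : (ell D ^ 9) ^ 100 = ell D ^ 900 := by rw [← pow_mul]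
  rw [hpow]
  calc (ell D ^ 1500)⁻¹ ≤ (ell D ^ 900)⁻¹ :=
        inv_anti₀ h900 (pow_le_pow_right₀ hℓ1 (by norm_num))
    _ = 1 / ell D ^ 900 := (one_div _).symm
    _ ≤ π ^ 100 / ell D ^ 900 := div_le_div_of_nonneg_right hπ h900.le

/-- **`Z22:§15.u021` HOLDS AS PRINTED** (`Typed.Section15A.Step15_u021 c'`, every `c′`): for `l₂ < PT⁻²`
(`l₂T ≤ P/T ≤ P < p ≤ Dpk`) the master form applies and `𝓛⁻¹⁵⁰⁰ ≤ α¹⁰⁰`. CONDITIONAL on (A) as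
every §§5–18 statement of the source; kernel theorem about the typed-as-printed display only.
[cite: Zhang2022LandauSiegel, §15 p.82 (u021)] -/
theorem step15_u021_holds (c' : ℝ) : Step15_u021 c' := by
  obtain ⟨C, hC0, D₀, hm⟩ := step15_u021_master c'
  obtain ⟨D₄, hD₄⟩ := exists_forall_le_ell (8 : ℝ)
  refine ⟨C, max D₀ D₄, fun D _ χ hD hq hprim hA p hp d₁ d₂ k l₂ hd₁ hd₂ hk hl₂ hdk hl₂P => ?_⟩
  have hD₀ : D₀ ≤ D := le_trans (le_max_left _ _) hD
  have hℓ8 : 8 ≤ ell D := hD₄ D (le_trans (le_max_right _ _) hD)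
  have hℓ4 : 4 ≤ ell D := by linarith only [hℓ8]
  obtain ⟨hD3r, -⟩ := DeltaContourShift.param_facts hℓ4
  have hP0 : 0 < bigP D := bigP_pos D
  have hT1 : 1 ≤ bigT D := by rw [bigT]; exact Real.one_le_exp (by positivity)
  have hT0 : 0 < bigT D := by linarith
  have hpP : bigP D < p := bigP_lt_of_mem_primeWindow hp
  have hkR : (1 : ℝ) ≤ k := by exact_mod_cast hk
  -- `l₂ T ≤ Dpk`
  have hlT : (l₂ : ℝ) * bigT D ≤ (D : ℝ) * p * k := by
    have h1 : (l₂ : ℝ) * bigT D ≤ bigP D / bigT D ^ 2 * bigT D :=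
      mul_le_mul_of_nonneg_right hl₂P.le hT0.le
    have h2 : bigP D / bigT D ^ 2 * bigT D ≤ bigP D := by
      rw [div_mul_eq_mul_div, div_le_iff₀ (by positivity)]
      have : bigT D ≤ bigT D ^ 2 := le_self_pow₀ hT1 (by norm_num)
      nlinarith only [this, hP0]
    have h3 : bigP D ≤ (D : ℝ) * p * k := by
      calc bigP D ≤ 1 * (p : ℝ) * 1 := by linarith only [hpP]
        _ ≤ (D : ℝ) * p * k := by gcongr; linarith only [hD3r]
    linarith only [h1, h2, h3]
  have h := hm D χ hD₀ hq hprim hA p hp d₁ d₂ k l₂ hd₁ hd₂ hk hl₂ hdk hlT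
  refine h.trans ?_
  have hy0 : 0 ≤ (D : ℝ) * p * k / l₂ := by
    have hp0 : (0 : ℝ) < p := pos_of_mem_primeWindow hp
    positivity
  have hτ0 : 0 ≤ tau 3 d₁ := MeanSquareMajorant.tau_nonneg _ _
  calc C * tau 3 d₁ * (ell D ^ 1500)⁻¹ * ((D : ℝ) * p * k / l₂)
      ≤ C * tau 3 d₁ * alpha D ^ 100 * ((D : ℝ) * p * k / l₂) := by
        gcongr
        exact inv_pow_le_alpha_pow' hℓ4
    _ = C * alpha D ^ 100 * tau 3 d₁ * ((D : ℝ) * p * k / l₂) := by ring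

end Main

end Literature.NumberTheory.LFunctions.Zhang2022.Typed.Section15A

end
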